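import Summits.BirchSwinnertonDyer.BirchSwinnertonDyer.Theses.QuadraticBranchSignedControl
import Summits.BirchSwinnertonDyer.Rank1Residual.Additive.QuadraticTowerRestrict
import Summits.BirchSwinnertonDyer.Rank1Residual.Additive.BaseChangeSubgroupH1
import HarnessLib

/-!
# Route `QuadraticBranchSignedControl` (rung K8, cell `bsd-potss`), crux `EtaTransportSigned`
# (item stmt-BirchSwinnertonDyer-19115): the last open frame `hSel` (ctrl's (i-c)) REDUCED to an
# IMAGE EQUALITY under ctrl's base-change isomorphism of subgroup cohomology — the Galois-group /
# coefficient half of (i-c) is DONE (ctrl's `BaseChange.subgroupH1Iso`, p405844); what remains is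
# the comparison of the LOCAL CONDITIONS only

WHAT. Frame `hSel` of `…EtaTransportFrameAOfSelmerComparison.lean` asks, for every quadratic
`F ∋ √p*` (and `κF = κ|_{Γ_F}`, `γF` a generator), for an additive isomorphism
`Ψ_A : Sel⁺(V_F/F_∞^{κF})` (Kobayashi Def. 1.1 inside `Γ_F`: `Kobayashi2003.signedSelmerInfty
(V.baseChange F) κF 1 ≤ H¹(ker κF, V_F[p^∞])`) `≃ Sel⁺(V/Fℚ_∞)` (cc-typer-6's
`towerSignedSelmerInfty V κ F ℚ_[p] 1 ≤ H¹(Gal(ℚ̄/Fℚ_∞), V[p^∞])`) intertwining `conj_{γF}` with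
`conj_{γF|_{ℚ̄}}`. The AMBIENT groups are already identified, Γ-compatibly, by ctrl's brick (i-c3):
`Θ := subgroupH1Iso ∘ res` : `H¹(ker κF, V_F[p^∞]) → H¹(res⁻¹ Gal(ℚ̄/Fℚ_∞), V_F[p^∞]) ≃ H¹(Gal(ℚ̄/Fℚ_∞), V[p^∞])`
(`ker κF = res⁻¹(Gal(ℚ̄/Fℚ_∞))`, ctrl's `kerSubgroup_restrictGal`; `subgroupH1Iso_conjH1`). So
`hSel` FOLLOWS from the image statement `hMap`: **`Θ(Sel⁺(V_F/F_∞)) = Sel⁺(V/Fℚ_∞)`** — an equality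
of additive subgroups of ONE group, i.e. purely the statement that the two families of local
conditions (classical Selmer conditions at all places of the layers; Kobayashi's plus condition at
the place above `p`, read over `F_𝔭·F_n` on the `F`-side and over `ℚ_p·Fℚ_n` at the model `ℚ_[p]`
on the `ℚ`-side) cut out the same classes. This file: `selmerComparison_of_map_eq : hMap → hSel`.

HONEST FRAMING (cell `bsd-potss`, run/shared/lean/pub/bsd-potss/; FULL-BSD rank ≤ 1 programme):
TOOL THEOREM ONLY — no definition, no named Literature fact, no `sorry`, axioms standard.
CONDITIONAL on the displayed frame `hMap` (WANTED; = the local-conditions half of ctrl's (i-c));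
closes nothing; nothing is booked; `BSD(W, p)` is claimed for no pair. Seat `bsd-potss-k8q-c3`
(prover), g0.

References: [Kobayashi2003] Def. 1.1 (p. 2), Def. 2.1 (p. 5), §2 p. 4; [SerreGaloisCohomology1997]
I.§2.4–2.5, II.§1.1; [GreenbergLNM1716] §1–§3.
-/

set_option autoImplicit false
set_option linter.dupNamespace false

noncomputable section

open scoped Classical

open Field WeierstrassCurve
open Literature.NumberTheory.EllipticCurves
open Literature.NumberTheory.GaloisRepresentations
open Summit.BirchSwinnertonDyer.Rank1Residual.Additive

namespace Summit.BirchSwinnertonDyer.BirchSwinnertonDyer.Theorems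

/-- **`hSel` from the image equality `hMap` under ctrl's `Θ = subgroupH1Iso ∘ res`.** For every
quadratic `F ∋ θ_F` etc., if `Θ` maps `Sel⁺(V_F/F_∞^{κF})` ONTO `Sel⁺(V/Fℚ_∞)` (`hMap`), then the
restriction of `Θ` is the required additive isomorphism, and it intertwines `conj_{γF}` with
`conj_{γF|_{ℚ̄}}` (`resOfLe_comp_conjH1`, `subgroupH1Iso_conjH1`); `Θ` is injective (`subgroupH1Iso`
bijective, restriction along equal subgroups injective). The conclusion is the hypothesis `hSel` of
`frameA_of_selmerComparison` VERBATIM. CONDITIONAL on `hMap`.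
[cite: Kobayashi2003, Def. 1.1 (p. 2), Def. 2.1 (p. 5)] [cite: SerreGaloisCohomology1997, I.§2.5, II.§1.1] -/
theorem selmerComparison_of_map_eq
    (hMap : ∀ (p : ℕ) [Fact p.Prime], 5 ≤ p →
      ∀ (V : WeierstrassCurve ℚ) [V.IsElliptic] [V.IsGloballyMinimal],
        V.HasGoodReductionAtPrime p → V.frobeniusTrace p = 0 →
      ∀ (κ : ZpExtension ℚ p), κ.IsCyclotomic →
      ∀ (F : Type) [Field F] [NumberField F] [(galRange (K := ℚ) F).Normal] (θF : F),
        Module.finrank ℚ F = 2 → θF ∉ Set.range (algebraMap ℚ F) →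
        θF ^ 2 = algebraMap ℚ F ((-1) ^ (p / 2) * p) →
      ∀ (hκ₀ : ∀ x, ∃ g ∈ galRange (K := ℚ) F, κ g = x),
        (Kobayashi2003.signedSelmerInfty (V.baseChange F) (BaseChange.restrictGal F κ hκ₀) 1).map
          ((BaseChange.subgroupH1Iso F V p
              ((towerTopSubgroup_le κ F 0).trans (towerSubgroup_le_galRange κ F 0))).toAddMonoidHom.comp
            ((V.baseChange F).resOfLe p (BaseChange.kerSubgroup_restrictGal F κ hκ₀).ge)) =
          towerSignedSelmerInfty V κ F ℚ_[p] 1) :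
    ∀ (p : ℕ) [Fact p.Prime], 5 ≤ p →
      ∀ (V : WeierstrassCurve ℚ) [V.IsElliptic] [V.IsGloballyMinimal],
        V.HasGoodReductionAtPrime p → V.frobeniusTrace p = 0 →
      ∀ (κ : ZpExtension ℚ p), κ.IsCyclotomic →
      ∀ (F : Type) [Field F] [NumberField F] [(galRange (K := ℚ) F).Normal] (θF : F),
        Module.finrank ℚ F = 2 → θF ∉ Set.range (algebraMap ℚ F) →
        θF ^ 2 = algebraMap ℚ F ((-1) ^ (p / 2) * p) →
      ∀ (hκ₀ : ∀ x, ∃ g ∈ galRange (K := ℚ) F, κ g = x) (γF : absoluteGaloisGroup F),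
        (BaseChange.restrictGal F κ hκ₀).IsTopGenerator γF →
      ∃ ΨA : Kobayashi2003.signedSelmerInfty (V.baseChange F) (BaseChange.restrictGal F κ hκ₀) 1 ≃+
          towerSignedSelmerInfty V κ F ℚ_[p] 1,
        ∀ s : Kobayashi2003.signedSelmerInfty (V.baseChange F) (BaseChange.restrictGal F κ hκ₀) 1,
          ((ΨA ⟨(V.baseChange F).conjH1 p (BaseChange.restrictGal F κ hκ₀).kerSubgroup γF s,
              Kobayashi2003.conjH1_mem_signedSelmerInfty (V.baseChange F)
                (BaseChange.restrictGal F κ hκ₀) 1 γF s.2⟩ :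
              towerSignedSelmerInfty V κ F ℚ_[p] 1) : V.subgroupH1 p (towerTopSubgroup κ F)) =
            V.conjH1 p (towerTopSubgroup κ F) (resGal (K := ℚ) F γF) (ΨA s) := by
  intro p _ hp5 V _ _ hgood hap κ hκ F _ _ _ θF h2 hθF hcF hκ₀ γF _
  set U := towerTopSubgroup κ F with hU
  have hUle : U ≤ galRange (K := ℚ) F :=
    (towerTopSubgroup_le κ F 0).trans (towerSubgroup_le_galRange κ F 0)
  set κF := BaseChange.restrictGal F κ hκ₀ with hκF
  have hle : BaseChange.comapResGal F U ≤ κF.kerSubgroup :=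
    (BaseChange.kerSubgroup_restrictGal F κ hκ₀).ge
  have hge : κF.kerSubgroup ≤ BaseChange.comapResGal F U :=
    (BaseChange.kerSubgroup_restrictGal F κ hκ₀).le
  set Θ : (V.baseChange F).subgroupH1 p κF.kerSubgroup →+ V.subgroupH1 p U :=
    (BaseChange.subgroupH1Iso F V p hUle).toAddMonoidHom.comp ((V.baseChange F).resOfLe p hle)
    with hΘ
  have hΘapply : ∀ x, Θ x = BaseChange.subgroupH1Iso F V p hUle ((V.baseChange F).resOfLe p hle x) :=
    fun x => rfl
  have hΘinj : Function.Injective Θ := by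
    intro a b hab
    rw [hΘapply, hΘapply] at hab
    exact resOfLe_injective_of_ge ((V.baseChange F).geomPrimaryTorsion p) hle hge
      ((BaseChange.subgroupH1Iso F V p hUle).injective hab)
  have himage := hMap p hp5 V hgood hap κ hκ F θF h2 hθF hcF hκ₀
  change (Kobayashi2003.signedSelmerInfty (V.baseChange F) κF 1).map Θ =
    towerSignedSelmerInfty V κ F ℚ_[p] 1 at himage
  refine ⟨((Kobayashi2003.signedSelmerInfty (V.baseChange F) κF 1).equivMapOfInjective Θ hΘinj).trans
      (AddEquiv.addSubgroupCongr himage), fun s => ?_⟩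
  change Θ ((V.baseChange F).conjH1 p κF.kerSubgroup γF s) = V.conjH1 p U (resGal (K := ℚ) F γF) (Θ s)
  rw [hΘapply, hΘapply, ← AddMonoidHom.comp_apply ((V.baseChange F).resOfLe p hle),
    resOfLe_comp_conjH1_holds (M := (V.baseChange F).geomPrimaryTorsion p) hle γF,
    AddMonoidHom.comp_apply]
  exact BaseChange.subgroupH1Iso_conjH1 F V p hUle γF _

end Summit.BirchSwinnertonDyer.BirchSwinnertonDyer.Theorems

end
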